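import Summits.PneNP.PneNP.Theorems.SfmBlCandAvoidLinearFP
import Summits.PneNP.PneNP.Theorems.Nc03AvoidResidualCoreResidualCoreReduction

/-!
# Line «sfm-bl» — the route target: `NC⁰₃-AVOID[n, C·n] ∈ FP`

Composition only (no new mathematics in this file): the pure-CAND core at linear stretch is in FP
(`candAvoidLinearFP`, this line's machine half + the cell's B-module, closed in
`SfmBlCandAvoidLinearFP`) and the residual-core reduction `CandAvoidLinearFP → LocalAvoidLinearFP 3 ⊤`
(`Summit.PneNP.PneNP.Theorems.residualCoreReduction_proof`, NPN bucketing + relaxation to pure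
instances + the non-CAND predicate classes) give the route's registered target
`Summit.PneNP.PneNP.Theses.Nc03AvoidResidualCore.Nc03AvoidLinearFP`
(= `Literature.Computability.Complexity.LocalAvoidLinearFP 3 (fun _ _ _ => True)`): one absolute
stretch constant `C` and one polynomial-time string function that, on every 3-local map with `n ≥ 1`
inputs and `m ≥ C·n` outputs, prints a string outside its range. The route's `Assembly` item is the
same modus ponens stated as an implication.

Scope (honest framing): a deterministic polynomial-time algorithm for a restricted-model total search
problem (range avoidance for `NC⁰₃` maps at linear stretch), kernel-checked against the tree's
definitions `LocalMap` / `range` / `encode` / `IsPolyTime`; it asserts nothing about `P` vs `NP`.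
-/

set_option linter.dupNamespace false -- `Summit.PneNP.PneNP.…`: summit = sub-problem name (D-0017 single-conjunct layout)

namespace Summit.PneNP.PneNP.Theorems.SfmBlMachine

open Summit.PneNP.PneNP.Theses.Nc03AvoidResidualCore

/-- **Route target** (item stmt-PneNP-19007): `NC⁰₃-AVOID` at linear stretch is solved by one
polynomial-time function — `LocalAvoidLinearFP 3 (fun _ _ _ => True)` — from the pure-CAND core
`candAvoidLinearFP` and the proved residual-core reduction `residualCoreReduction_proof`. -/
theorem nc03AvoidLinearFP : Summit.PneNP.PneNP.Theses.Nc03AvoidResidualCore.Nc03AvoidLinearFP :=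
  Summit.PneNP.PneNP.Theorems.residualCoreReduction_proof candAvoidLinearFP

/-- **Assembly** (item stmt-PneNP-20228): `CandAvoidLinearFP → ResidualCoreReduction →
LocalAvoidLinearFP 3 (fun _ _ _ => True)` — the reduction applied to the core (modus ponens). -/
theorem nc03AvoidResidualCore_assembly : Summit.PneNP.PneNP.Theses.Nc03AvoidResidualCore.Assembly :=
  fun h₁ h₃ => h₃ h₁

end Summit.PneNP.PneNP.Theorems.SfmBlMachine
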